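import Mathlib
import Summits.Ventures.HodgeRepro2.Tier7.Line3.SchurProjector
import Summits.Ventures.HodgeRepro2.Tier7.Line3.WeightProjectorStrong

/-!
# Tier7/Line3/ProjectorPeriod — `P_A ∘ R(f) = P_A`: the one-vector projector loses nothing on the A-side (seat t7-L1-p4)

LINE 3 (t7-plan-3), version (ii), memo v13 §2g properties (2) + (3) composed BY NAME, at the compact place in the
abstract: `G` a compact group (left-invariant probability measure `μG`), `τ` a continuous irreducible unitary
representation on the finite-dimensional `V` (the `τ`-space of the Fock data), `u ∈ V` of norm `1`, and the integrated
form of the line's test function `f(g) = d · ⟪τ g u, u⟫`,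

  `oneVectorOp μG τ u v := d • ∫ ⟪τ g u, u⟫ • τ g v dμG`  (`R(f) v` on the `τ`-space);

`T` a compact group with a continuous homomorphism `ι : T →* G` (the torus `T_A(F_{ι₁})` inside `U(W_A)(F_{ι₁})`),
`χ : T →* ℂ` a continuous unitary character (`μ_{A,ι₁}`), `u` a `χ`-weight vector of `τ ∘ ι` spanning the `χ`-weight
space (multiplicity one), and `P : V →L[ℂ] ℂ` a `χ`-equivariant functional (`P (τ (ι t) v) = χ t * P v` — the A-period
on this copy). Then

* `oneVectorOp_eq`: `R(f) v = ⟪u, v⟫ • u` (`SchurProjector.integral_inner_smul_apply_self`) — the orthogonal projection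
  onto `ℂ u`;
* `oneVectorOpOn_eq_zero`: the same integral against `σ g` vanishes for an irreducible `σ ≇ τ`
  (`SchurProjector.integral_inner_smul_apply_eq_zero`) — `R(f)` kills the other isotypic parts;
* **`apply_oneVectorOp`**: `P (R(f) v) = P v` (`WeightProjectorStrong.apply_eq_inner_mul_of_equivariant`) — the A-period of
  the projected vector is the A-period of the vector: nothing is lost on the A-side.

The torus side uses `WeightProjectorStrong` (pointwise continuity only — crit-2 l. 15231), derived here from the norm
continuity of `τ` on the finite-dimensional `V` of the compact place. What stays in words: the dictionary (`U(W_A)(F_{ι₁})`, `τ`, `T_A`, `μ_A`, `u_A`, the period functional), the isotypic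
decomposition of `L²` into copies of `τ` (printed), and the multiplicity one of the weight (printed). Nothing about (N);
no device. No sorry; axioms ⊆ {propext, Classical.choice, Quot.sound}.
-/

namespace Summit.Ventures.HodgeRepro2.Tier7.Line3.ProjectorPeriod

open MeasureTheory
open scoped InnerProductSpace
open Summit.Ventures.HodgeRepro2.Tier7.Line3

variable {G : Type*} [Group G] [TopologicalSpace G] [IsTopologicalGroup G] [CompactSpace G] [MeasurableSpace G]
  [BorelSpace G]
variable {V : Type*} [NormedAddCommGroup V] [InnerProductSpace ℂ V]

/-- the integrated form of the one-vector coefficient `f(g) = d · ⟪τ g u, u⟫`: `R(f) v = d • ∫ ⟪τ g u, u⟫ • τ g v`. -/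
noncomputable def oneVectorOp (μ : Measure G) (τ : G →* (V →L[ℂ] V)) (u v : V) : V :=
  (Module.finrank ℂ V : ℂ) • ∫ g, ⟪τ g u, u⟫_ℂ • τ g v ∂μ

/-- **`R(f)` is the orthogonal projection onto `ℂ u`** (τ irreducible unitary, `‖u‖ = 1` for the projector reading):
`R(f) v = ⟪u, v⟫ • u`. -/
theorem oneVectorOp_eq [FiniteDimensional ℂ V] [CompleteSpace V] (μ : Measure G) [IsProbabilityMeasure μ]
    [μ.IsMulLeftInvariant] (τ : G →* (V →L[ℂ] V))
    (hτ : Continuous τ) (hτu : SchurProjector.IsUnitaryRep τ) (hτi : SchurProjector.IsIrreducible τ) (u v : V) :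
    oneVectorOp μ τ u v = ⟪u, v⟫_ℂ • u :=
  SchurProjector.integral_inner_smul_apply_self μ τ hτ hτu hτi u v

/-- the same integral against another representation `σ`: `d • ∫ ⟪τ g u, u⟫ • σ g v`. -/
noncomputable def oneVectorOpOn {W : Type*} [NormedAddCommGroup W] [InnerProductSpace ℂ W] (μ : Measure G)
    (τ : G →* (V →L[ℂ] V)) (u : V) (σ : G →* (W →L[ℂ] W)) (v : W) : W :=
  (Module.finrank ℂ V : ℂ) • ∫ g, ⟪τ g u, u⟫_ℂ • σ g v ∂μ

/-- **`R(f)` kills every irreducible `σ ≇ τ`**: `d • ∫ ⟪τ g u, u⟫ • σ g v = 0`. -/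
theorem oneVectorOpOn_eq_zero {W : Type*} [NormedAddCommGroup W] [InnerProductSpace ℂ W] [CompleteSpace W]
    (μ : Measure G) [IsProbabilityMeasure μ] [μ.IsMulLeftInvariant] (τ : G →* (V →L[ℂ] V)) (hτ : Continuous τ)
    (hτu : SchurProjector.IsUnitaryRep τ) (hτi : SchurProjector.IsIrreducible τ) (u : V)
    (σ : G →* (W →L[ℂ] W)) (hσ : Continuous σ) (hσi : SchurProjector.IsIrreducible σ)
    (hne : ¬ SchurProjector.IsEquivIso σ τ) (v : W) : oneVectorOpOn μ τ u σ v = 0 := by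
  unfold oneVectorOpOn
  rw [SchurProjector.integral_inner_smul_apply_eq_zero μ σ τ hσ hτ hτu hσi hτi hne u v u, smul_zero]

variable {T : Type*} [Group T] [TopologicalSpace T] [IsTopologicalGroup T] [CompactSpace T] [MeasurableSpace T]
  [BorelSpace T]

/-- **`P_A ∘ R(f) = P_A` — the A-side loses nothing**: for a `χ`-equivariant functional `P` under the torus `ι : T →* G`
and `u` spanning the `χ`-weight space (multiplicity one, `‖u‖ = 1`), `P (R(f) v) = P v` for every `v`. -/
theorem apply_oneVectorOp [FiniteDimensional ℂ V] [CompleteSpace V] (μG : Measure G) [IsProbabilityMeasure μG]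
    [μG.IsMulLeftInvariant]
    (μT : Measure T) [IsProbabilityMeasure μT] [μT.IsMulLeftInvariant]
    (τ : G →* (V →L[ℂ] V)) (hτ : Continuous τ) (hτu : SchurProjector.IsUnitaryRep τ)
    (hτi : SchurProjector.IsIrreducible τ) (ι : T →* G) (hι : Continuous ι) (χ : T →* ℂ) (hχ : Continuous χ)
    (hχu : WeightProjectorStrong.IsUnitaryChar χ) {u : V} (hu : WeightProjectorStrong.IsWeightVector (τ.comp ι) χ u)
    (hu1 : ‖u‖ = 1) (hmult : ∀ w, WeightProjectorStrong.IsWeightVector (τ.comp ι) χ w → ∃ c : ℂ, w = c • u)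
    (P : V →L[ℂ] ℂ) (hP : ∀ t v, P (τ (ι t) v) = χ t * P v) (v : V) :
    P (oneVectorOp μG τ u v) = P v := by
  rw [oneVectorOp_eq μG τ hτ hτu hτi, map_smul, smul_eq_mul]
  have hτι : ∀ w, Continuous fun t => (τ.comp ι) t w := fun w => (hτ.comp hι).clm_apply continuous_const
  have hτιu : WeightProjectorStrong.IsUnitaryRep (τ.comp ι) := fun t x y => hτu (ι t) x y
  exact (WeightProjectorStrong.apply_eq_inner_mul_of_equivariant μT (τ.comp ι) χ hτι hτιu hχ hχu hu hu1 hmult P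
    (fun t v => hP t v) v).symm

end Summit.Ventures.HodgeRepro2.Tier7.Line3.ProjectorPeriod
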